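import Summits.Ventures.PercRepro.C025ProfileTopHallNullityLemmas

/-!
# THE DISJOINTNESS LEMMA AT EVERY NULLITY (night-3 g22)

For every finite matroid `N`, every `k` and every family `ℬ` of subsets of `E` of nullity `≤ k` (each
containing an independent set missing at most `k` of its points), the sets of nullity `≤ k` DISJOINT from some
member of `ℬ` are at least as many as the members:
  `#ℬ ≤ #{T ⊆ E : ν(T) ≤ k ∧ ∃ B ∈ ℬ, T ∩ B = ∅}`.
At `k = 0` this is the disjointness lemma of `C025ProfileTopHallDisjoint`; the proof is the same induction on
`|E|` through a point `e`, with the second instance taken in `N ／ e` at the same `k` when `e` is not a loop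
(`ν_{N／e}(T) = ν_N(T ∪ e)`) and in `N ＼ e` at `k − 1` when `e` is a loop (`ν_N(T ∪ e) = ν_N(T) + 1`); the
two cases share the step `card_le_card_nullity_disjoint_step` (a second instance `N₂` on `E ∖ e` with two
transfer properties).  In `M = N✶` a set of nullity `≤ k` is a set `B` such that `(E ∖ B) ∪ X` is spanning for
some `X ⊆ B` with `|X| ≤ k` («coindependent up to `k` points», `ρ(E ∖ B) ≥ ρ(E) − k`), and the candidates are
the complements of such sets: for every family `𝒜` of sets coindependent up to `k` points, the sets `S ⊇ some
B ∈ 𝒜` spanning up to `k` points (`ρ(S) ≥ ρ(E) − k`) number at least the members.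
* `card_le_card_nullity_disjoint_step`, `card_le_card_nullity_disjoint_aux` — the induction;
* **`card_le_card_nullity_disjoint (N) [N.Finite] (k) (ℬ) (hℬ : ∀ B ∈ ℬ, B ⊆ E ∧ ν(B) ≤ k) : #ℬ ≤ #{T ⊆ E :
  ν(T) ≤ k ∧ ∃ B ∈ ℬ, Disjoint T B}`** — the disjointness lemma at nullity `k`;
* **`card_le_card_spanning_upto (k) (𝒜) (h𝒜 : ∀ B ∈ 𝒜, B ⊆ E ∧ ∃ X ⊆ B, |X| ≤ k ∧ M.Spanning ((E ∖ B) ∪ X)) :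
  #𝒜 ≤ #{S ⊆ E : (∃ X ⊆ E ∖ S, |X| ≤ k ∧ M.Spanning (S ∪ X)) ∧ ∃ B ∈ 𝒜, B ⊆ S}`** — the lemma in `M`'s own
  language (the top row `k = 0` is `card_coindep_le_card_spanning`).
No `def`, no `instance`, no notation.  Axioms: standard.
-/

open scoped Matroid

namespace PercRepro

open Set Finset ThmH

namespace TopHall

variable {α : Type} [DecidableEq α]

open scoped Classical in
/-- **The step of the induction** (the common part of the loop and non-loop cases).  `N` has `n + 1` points, `e`
is one of them, `ih` is the statement for every matroid on `n` points and every nullity, and `N₂` is the second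
instance: a matroid on `E ∖ e` (`N ／ e` or `N ＼ e`) with a nullity `k₂` such that (P1) a member `B ∌ e` with
`ν_N(B ∪ e) ≤ k` has `ν_{N₂}(B) ≤ k₂`, and (P2) a candidate `T` of `N₂` for such a family gives the candidate
`T ∪ e` of `N`.  The candidates avoiding `e` are the candidates of `N ＼ e` for `ℬ₀ ∪ ℬ₁`, the candidates through
`e` are `e` plus the candidates of `N₂` for `ℬ₀′ = {B ∈ ℬ₀ : ν_N(B ∪ e) ≤ k}`, and `ℬ₀ ∩ ℬ₁ ⊆ ℬ₀′`. -/
theorem card_le_card_nullity_disjoint_step (n : ℕ)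
    (ih : ∀ (N' : Matroid α) [N'.Finite], (gr N').card = n → ∀ (k' : ℕ) (ℬ' : Finset (Finset α)),
      (∀ B ∈ ℬ', B ⊆ gr N' ∧ ∃ I ⊆ B, N'.Indep (I : Set α) ∧ (B \ I).card ≤ k') →
      ℬ'.card ≤ ((gr N').powerset.filter (fun T : Finset α =>
        (∃ I ⊆ T, N'.Indep (I : Set α) ∧ (T \ I).card ≤ k') ∧ ∃ B ∈ ℬ', Disjoint T B)).card)
    (N : Matroid α) [N.Finite] (hn : (gr N).card = n + 1) (e : α) (he : e ∈ gr N)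
    (k : ℕ) (ℬ : Finset (Finset α))
    (hℬ : ∀ B ∈ ℬ, B ⊆ gr N ∧ ∃ I ⊆ B, N.Indep (I : Set α) ∧ (B \ I).card ≤ k)
    (N₂ : Matroid α) [N₂.Finite] (hgr₂ : gr N₂ = (gr N).erase e) (k₂ : ℕ)
    (hP1 : ∀ B : Finset α, e ∉ B → B ⊆ gr N →
      (∃ I ⊆ insert e B, N.Indep (I : Set α) ∧ (insert e B \ I).card ≤ k) →
      ∃ I ⊆ B, N₂.Indep (I : Set α) ∧ (B \ I).card ≤ k₂)
    (hP2 : ∀ T : Finset α, e ∉ T → T ⊆ gr N →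
      (∃ I ⊆ T, N₂.Indep (I : Set α) ∧ (T \ I).card ≤ k₂) →
      (∃ B ∈ ℬ, e ∉ B ∧ ∃ I ⊆ insert e B, N.Indep (I : Set α) ∧ (insert e B \ I).card ≤ k) →
      ∃ I ⊆ insert e T, N.Indep (I : Set α) ∧ (insert e T \ I).card ≤ k) :
    ℬ.card ≤ ((gr N).powerset.filter (fun T : Finset α =>
      (∃ I ⊆ T, N.Indep (I : Set α) ∧ (T \ I).card ≤ k) ∧ ∃ B ∈ ℬ, Disjoint T B)).card := by
  -- the deletion N ＼ e
  have hgr1 : gr (N ＼ ({e} : Set α)) = (gr N).erase e := gr_delete_singleton N e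
  have hcard1 : (gr (N ＼ ({e} : Set α))).card = n := by
    rw [hgr1, Finset.card_erase_of_mem he, hn]
    rfl
  have hcard2 : (gr N₂).card = n := by
    rw [hgr₂, Finset.card_erase_of_mem he, hn]
    rfl
  -- the split of the family
  set ℬ₀ := ℬ.filter (fun B : Finset α => e ∉ B) with hℬ₀
  set ℬ₁ := (ℬ.filter (fun B : Finset α => e ∈ B)).image (fun B : Finset α => B.erase e) with hℬ₁
  set ℬ₀' := ℬ₀.filter (fun B : Finset α =>
    ∃ I ⊆ insert e B, N.Indep (I : Set α) ∧ (insert e B \ I).card ≤ k) with hℬ₀'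
  -- members of ℬ₀ ∪ ℬ₁ are sets of E ∖ e of nullity ≤ k in N ＼ e
  have hmem1 : ∀ B ∈ ℬ₀ ∪ ℬ₁, B ⊆ gr (N ＼ ({e} : Set α)) ∧
      ∃ I ⊆ B, (N ＼ ({e} : Set α)).Indep (I : Set α) ∧ (B \ I).card ≤ k := by
    intro B hB
    rw [hgr1]
    rw [Finset.mem_union] at hB
    rcases hB with hB | hB
    · rw [hℬ₀, Finset.mem_filter] at hB
      obtain ⟨hBg, hBn⟩ := hℬ B hB.1
      refine ⟨fun x hx => Finset.mem_erase.2 ⟨fun hxe => hB.2 (hxe ▸ hx), hBg hx⟩, ?_⟩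
      exact (nullity_le_delete_iff hB.2).2 hBn
    · rw [hℬ₁, Finset.mem_image] at hB
      obtain ⟨B', hB', rfl⟩ := hB
      rw [Finset.mem_filter] at hB'
      obtain ⟨hBg, hBn⟩ := hℬ B' hB'.1
      refine ⟨Finset.erase_subset_erase e hBg, ?_⟩
      exact (nullity_le_delete_iff (Finset.notMem_erase e B')).2 (nullity_le_erase e hBn)
  -- members of ℬ₀' are sets of E ∖ e of nullity ≤ k₂ in N₂
  have hmem2 : ∀ B ∈ ℬ₀', B ⊆ gr N₂ ∧ ∃ I ⊆ B, N₂.Indep (I : Set α) ∧ (B \ I).card ≤ k₂ := by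
    intro B hB
    rw [hℬ₀', Finset.mem_filter, hℬ₀, Finset.mem_filter] at hB
    obtain ⟨hBg, _⟩ := hℬ B hB.1.1
    rw [hgr₂]
    exact ⟨fun x hx => Finset.mem_erase.2 ⟨fun hxe => hB.1.2 (hxe ▸ hx), hBg hx⟩, hP1 B hB.1.2 hBg hB.2⟩
  -- the two induction hypotheses
  have ih1 := ih (N ＼ ({e} : Set α)) hcard1 k (ℬ₀ ∪ ℬ₁) hmem1
  have ih2 := ih N₂ hcard2 k₂ ℬ₀' hmem2
  -- the candidates of N ＼ e for ℬ₀ ∪ ℬ₁ are candidates of N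
  have hsub1 : ((gr (N ＼ ({e} : Set α))).powerset.filter (fun T : Finset α =>
      (∃ I ⊆ T, (N ＼ ({e} : Set α)).Indep (I : Set α) ∧ (T \ I).card ≤ k) ∧ ∃ B ∈ ℬ₀ ∪ ℬ₁, Disjoint T B)) ⊆
      (gr N).powerset.filter (fun T : Finset α =>
        (∃ I ⊆ T, N.Indep (I : Set α) ∧ (T \ I).card ≤ k) ∧ ∃ B ∈ ℬ, Disjoint T B) := by
    intro T hT
    rw [Finset.mem_filter, Finset.mem_powerset, hgr1] at hT
    obtain ⟨hTg, hTn, B', hB', hdisj⟩ := hT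
    have heT : e ∉ T := fun h => (Finset.mem_erase.1 (hTg h)).1 rfl
    rw [Finset.mem_filter, Finset.mem_powerset]
    refine ⟨hTg.trans (Finset.erase_subset e _), (nullity_le_delete_iff heT).1 hTn, ?_⟩
    rw [Finset.mem_union] at hB'
    rcases hB' with hB' | hB'
    · rw [hℬ₀, Finset.mem_filter] at hB'
      exact ⟨B', hB'.1, hdisj⟩
    · rw [hℬ₁, Finset.mem_image] at hB'
      obtain ⟨B, hB, rfl⟩ := hB'
      rw [Finset.mem_filter] at hB
      refine ⟨B, hB.1, ?_⟩
      rw [Finset.disjoint_left]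
      intro x hxT hxB
      exact (Finset.disjoint_left.1 hdisj) hxT (Finset.mem_erase.2 ⟨fun hxe => heT (hxe ▸ hxT), hxB⟩)
  -- the candidates of N₂ for ℬ₀', with e inserted, are candidates of N
  have hsub2 : ((gr N₂).powerset.filter (fun T : Finset α =>
      (∃ I ⊆ T, N₂.Indep (I : Set α) ∧ (T \ I).card ≤ k₂) ∧ ∃ B ∈ ℬ₀', Disjoint T B)).image
        (fun T : Finset α => insert e T) ⊆
      (gr N).powerset.filter (fun T : Finset α =>
        (∃ I ⊆ T, N.Indep (I : Set α) ∧ (T \ I).card ≤ k) ∧ ∃ B ∈ ℬ, Disjoint T B) := by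
    intro S hS
    rw [Finset.mem_image] at hS
    obtain ⟨T, hT, rfl⟩ := hS
    rw [Finset.mem_filter, Finset.mem_powerset, hgr₂] at hT
    obtain ⟨hTg, hTn, B, hB, hdisj⟩ := hT
    have heT : e ∉ T := fun h => (Finset.mem_erase.1 (hTg h)).1 rfl
    have hTg' : T ⊆ gr N := hTg.trans (Finset.erase_subset e _)
    rw [hℬ₀', Finset.mem_filter, hℬ₀, Finset.mem_filter] at hB
    rw [Finset.mem_filter, Finset.mem_powerset]
    refine ⟨Finset.insert_subset he hTg', hP2 T heT hTg' hTn ⟨B, hB.1.1, hB.1.2, hB.2⟩, B, hB.1.1, ?_⟩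
    rw [Finset.disjoint_left]
    intro x hxT hxB
    rw [Finset.mem_insert] at hxT
    rcases hxT with rfl | hxT
    · exact hB.1.2 hxB
    · exact (Finset.disjoint_left.1 hdisj) hxT hxB
  -- the two candidate families are disjoint (e ∉ T versus e ∈ T)
  have hdisj12 : Disjoint
      ((gr (N ＼ ({e} : Set α))).powerset.filter (fun T : Finset α =>
        (∃ I ⊆ T, (N ＼ ({e} : Set α)).Indep (I : Set α) ∧ (T \ I).card ≤ k) ∧ ∃ B ∈ ℬ₀ ∪ ℬ₁, Disjoint T B))
      (((gr N₂).powerset.filter (fun T : Finset α =>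
        (∃ I ⊆ T, N₂.Indep (I : Set α) ∧ (T \ I).card ≤ k₂) ∧ ∃ B ∈ ℬ₀', Disjoint T B)).image
          (fun T : Finset α => insert e T)) := by
    rw [Finset.disjoint_left]
    intro T hT1 hT2
    rw [Finset.mem_filter, Finset.mem_powerset, hgr1] at hT1
    rw [Finset.mem_image] at hT2
    obtain ⟨T', _, rfl⟩ := hT2
    exact (Finset.mem_erase.1 (hT1.1 (Finset.mem_insert_self e T'))).1 rfl
  -- the insertion of e is injective on sets avoiding e
  have hinj : ((gr N₂).powerset.filter (fun T : Finset α =>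
      (∃ I ⊆ T, N₂.Indep (I : Set α) ∧ (T \ I).card ≤ k₂) ∧ ∃ B ∈ ℬ₀', Disjoint T B)).card =
      (((gr N₂).powerset.filter (fun T : Finset α =>
        (∃ I ⊆ T, N₂.Indep (I : Set α) ∧ (T \ I).card ≤ k₂) ∧ ∃ B ∈ ℬ₀', Disjoint T B)).image
          (fun T : Finset α => insert e T)).card := by
    rw [Finset.card_image_of_injOn]
    intro T hT T' hT' heq
    rw [Finset.mem_coe, Finset.mem_filter, Finset.mem_powerset, hgr₂] at hT hT'
    have h1 : e ∉ T := fun h => (Finset.mem_erase.1 (hT.1 h)).1 rfl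
    have h2 : e ∉ T' := fun h => (Finset.mem_erase.1 (hT'.1 h)).1 rfl
    simp only at heq
    rw [← Finset.erase_insert h1, ← Finset.erase_insert h2, heq]
  -- counting the family: #ℬ = #ℬ₀ + #ℬ₁, #(ℬ₀ ∪ ℬ₁) + #(ℬ₀ ∩ ℬ₁) = #ℬ₀ + #ℬ₁, ℬ₀ ∩ ℬ₁ ⊆ ℬ₀'
  have hc1 : ℬ.card = ℬ₀.card + ℬ₁.card := by
    rw [hℬ₁, Finset.card_image_of_injOn, hℬ₀, add_comm, Finset.card_filter_add_card_filter_not]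
    intro B hB B' hB' heq
    rw [Finset.mem_coe, Finset.mem_filter] at hB hB'
    simp only at heq
    rw [← Finset.insert_erase hB.2, ← Finset.insert_erase hB'.2, heq]
  have hc2 : (ℬ₀ ∪ ℬ₁).card + (ℬ₀ ∩ ℬ₁).card = ℬ₀.card + ℬ₁.card :=
    Finset.card_union_add_card_inter _ _
  have hc3 : ℬ₀ ∩ ℬ₁ ⊆ ℬ₀' := by
    intro B hB
    rw [Finset.mem_inter] at hB
    rw [hℬ₀', Finset.mem_filter]
    refine ⟨hB.1, ?_⟩
    have hB1 := hB.2
    rw [hℬ₁, Finset.mem_image] at hB1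
    obtain ⟨B', hB', rfl⟩ := hB1
    rw [Finset.mem_filter] at hB'
    rw [Finset.insert_erase hB'.2]
    exact (hℬ B' hB'.1).2
  have hc4 : (ℬ₀ ∩ ℬ₁).card ≤ ℬ₀'.card := Finset.card_le_card hc3
  -- assemble
  have hunion : (((gr (N ＼ ({e} : Set α))).powerset.filter (fun T : Finset α =>
        (∃ I ⊆ T, (N ＼ ({e} : Set α)).Indep (I : Set α) ∧ (T \ I).card ≤ k) ∧ ∃ B ∈ ℬ₀ ∪ ℬ₁, Disjoint T B)) ∪
      (((gr N₂).powerset.filter (fun T : Finset α =>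
        (∃ I ⊆ T, N₂.Indep (I : Set α) ∧ (T \ I).card ≤ k₂) ∧ ∃ B ∈ ℬ₀', Disjoint T B)).image
          (fun T : Finset α => insert e T))).card ≤
      ((gr N).powerset.filter (fun T : Finset α =>
        (∃ I ⊆ T, N.Indep (I : Set α) ∧ (T \ I).card ≤ k) ∧ ∃ B ∈ ℬ, Disjoint T B)).card :=
    Finset.card_le_card (Finset.union_subset hsub1 hsub2)
  rw [Finset.card_union_of_disjoint hdisj12, ← hinj] at hunion
  omega

open scoped Classical in
/-- **The disjointness lemma at every nullity**, in the form used for the induction on the size of the ground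
set: for every finite matroid `N` on `n` points, every `k` and every family `ℬ` of subsets of `E` of nullity
`≤ k`, `#ℬ ≤ #{T ⊆ E of nullity ≤ k : T disjoint from some member of ℬ}`. -/
theorem card_le_card_nullity_disjoint_aux (n : ℕ) : ∀ (N : Matroid α) [N.Finite], (gr N).card = n →
    ∀ (k : ℕ) (ℬ : Finset (Finset α)),
      (∀ B ∈ ℬ, B ⊆ gr N ∧ ∃ I ⊆ B, N.Indep (I : Set α) ∧ (B \ I).card ≤ k) →
      ℬ.card ≤ ((gr N).powerset.filter (fun T : Finset α =>
        (∃ I ⊆ T, N.Indep (I : Set α) ∧ (T \ I).card ≤ k) ∧ ∃ B ∈ ℬ, Disjoint T B)).card := by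
  induction n with
  | zero =>
    intro N _ hn k ℬ hℬ
    rw [Finset.card_eq_zero] at hn
    -- every member of ℬ is empty
    have hsub : ℬ ⊆ {∅} := by
      intro B hB
      rw [Finset.mem_singleton]
      have h1 := (hℬ B hB).1
      rw [hn, Finset.subset_empty] at h1
      exact h1
    rcases Finset.eq_empty_or_nonempty ℬ with hempty | hne
    · rw [hempty, Finset.card_empty]
      exact Nat.zero_le _
    · have h1 : ℬ.card ≤ 1 := by
        calc ℬ.card ≤ ({∅} : Finset (Finset α)).card := Finset.card_le_card hsub
          _ = 1 := Finset.card_singleton _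
      have h2 : ∅ ∈ ℬ := by
        obtain ⟨B, hB⟩ := hne.exists_mem
        have := hsub hB
        rw [Finset.mem_singleton] at this
        rw [← this]
        exact hB
      have h3 : (∅ : Finset α) ∈ (gr N).powerset.filter (fun T : Finset α =>
          (∃ I ⊆ T, N.Indep (I : Set α) ∧ (T \ I).card ≤ k) ∧ ∃ B ∈ ℬ, Disjoint T B) := by
        rw [Finset.mem_filter, Finset.mem_powerset]
        refine ⟨Finset.empty_subset _, ⟨∅, Finset.Subset.refl _, by rw [Finset.coe_empty]; exact N.empty_indep,
          by rw [Finset.sdiff_empty, Finset.card_empty]; exact Nat.zero_le _⟩, ∅, h2, Finset.disjoint_empty_left _⟩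
      exact h1.trans (Finset.card_pos.2 ⟨∅, h3⟩)
  | succ n ih =>
    intro N _ hn k ℬ hℬ
    -- pick a point e of the ground set
    have hne : (gr N).Nonempty := by
      rw [← Finset.card_pos, hn]
      exact Nat.succ_pos n
    obtain ⟨e, he⟩ := hne.exists_mem
    by_cases hloop : N.Indep ({e} : Set α)
    · -- e is not a loop: the second instance is N ／ e at the same k
      refine card_le_card_nullity_disjoint_step n ih N hn e he k ℬ hℬ (N ／ ({e} : Set α))
        (gr_contract_singleton N e) k ?_ ?_
      · intro B heB hBg hBn
        have hB' : ((insert e B : Finset α) : Set α) ⊆ N.E := by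
          rw [Finset.coe_insert, Set.insert_subset_iff, ← coe_gr]
          exact ⟨Finset.mem_coe.2 he, Finset.coe_subset.2 hBg⟩
        exact (nullity_le_contract_iff hloop heB hB').2 hBn
      · intro T heT hTg hTn _
        have hT' : ((insert e T : Finset α) : Set α) ⊆ N.E := by
          rw [Finset.coe_insert, Set.insert_subset_iff, ← coe_gr]
          exact ⟨Finset.mem_coe.2 he, Finset.coe_subset.2 hTg⟩
        exact (nullity_le_contract_iff hloop heT hT').1 hTn
    · -- e is a loop: the second instance is N ＼ e at k − 1
      refine card_le_card_nullity_disjoint_step n ih N hn e he k ℬ hℬ (N ＼ ({e} : Set α))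
        (gr_delete_singleton N e) (k - 1) ?_ ?_
      · intro B heB _ hBn
        exact (nullity_le_delete_iff heB).2 ((nullity_le_insert_loop_iff hloop heB).1 hBn).2
      · intro T heT _ hTn hB
        obtain ⟨B, _, heB, hBn⟩ := hB
        have hk : 1 ≤ k := ((nullity_le_insert_loop_iff hloop heB).1 hBn).1
        exact (nullity_le_insert_loop_iff hloop heT).2 ⟨hk, (nullity_le_delete_iff heT).1 hTn⟩

open scoped Classical in
/-- **THE DISJOINTNESS LEMMA AT EVERY NULLITY**: for every finite matroid `N`, every `k` and every family `ℬ` of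
subsets of `E` of nullity `≤ k` (each containing an independent set missing at most `k` of its points), the
sets of nullity `≤ k` disjoint from some member of `ℬ` are at least as many as the members. -/
theorem card_le_card_nullity_disjoint (N : Matroid α) [N.Finite] (k : ℕ) (ℬ : Finset (Finset α))
    (hℬ : ∀ B ∈ ℬ, B ⊆ gr N ∧ ∃ I ⊆ B, N.Indep (I : Set α) ∧ (B \ I).card ≤ k) :
    ℬ.card ≤ ((gr N).powerset.filter (fun T : Finset α =>
      (∃ I ⊆ T, N.Indep (I : Set α) ∧ (T \ I).card ≤ k) ∧ ∃ B ∈ ℬ, Disjoint T B)).card :=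
  card_le_card_nullity_disjoint_aux (gr N).card N rfl k ℬ hℬ

open scoped Classical in
/-- **Families coindependent up to `k` points have at least as many supersets spanning up to `k` points**: for
every family `𝒜` of subsets `B` of `E` such that `(E ∖ B) ∪ X` is spanning for some `X ⊆ B` with `|X| ≤ k`
(`ρ(E ∖ B) ≥ ρ(E) − k`), the sets `S ⊇ some B ∈ 𝒜` such that `S ∪ X` is spanning for some `X ⊆ E ∖ S` with
`|X| ≤ k` (`ρ(S) ≥ ρ(E) − k`) number at least the members — the disjointness lemma at nullity `k` in `M✶`, the
candidates `T` mapped to `E ∖ T`; at `k = 0` this is `card_coindep_le_card_spanning`. -/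
theorem card_le_card_spanning_upto {M : Matroid α} [M.Finite] (k : ℕ) (𝒜 : Finset (Finset α))
    (h𝒜 : ∀ B ∈ 𝒜, B ⊆ gr M ∧ ∃ X ⊆ B, X.card ≤ k ∧ M.Spanning (((gr M \ B) ∪ X : Finset α) : Set α)) :
    𝒜.card ≤ ((gr M).powerset.filter (fun S : Finset α =>
      (∃ X ⊆ gr M \ S, X.card ≤ k ∧ M.Spanning ((S ∪ X : Finset α) : Set α)) ∧ ∃ B ∈ 𝒜, B ⊆ S)).card := by
  -- the members have nullity ≤ k in the dual
  have hmem : ∀ B ∈ 𝒜, B ⊆ gr (M✶) ∧ ∃ I ⊆ B, (M✶).Indep (I : Set α) ∧ (B \ I).card ≤ k := by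
    intro B hB
    obtain ⟨hBg, X, hXB, hXk, hXs⟩ := h𝒜 B hB
    rw [gr_dual]
    refine ⟨hBg, B \ X, Finset.sdiff_subset, ?_, ?_⟩
    · have hsub : ((B \ X : Finset α) : Set α) ⊆ M.E := by
        rw [← coe_gr, Finset.coe_subset]
        exact Finset.sdiff_subset.trans hBg
      rw [← Matroid.coindep_def, Matroid.coindep_iff_compl_spanning hsub]
      have h1 : M.E \ ((B \ X : Finset α) : Set α) = (((gr M \ B) ∪ X : Finset α) : Set α) := by
        rw [← coe_gr, Finset.coe_union, Finset.coe_sdiff, Finset.coe_sdiff]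
        ext x
        simp only [Set.mem_sdiff, Set.mem_union, Finset.mem_coe]
        constructor
        · rintro ⟨hxg, hx⟩
          by_cases hxB : x ∈ B
          · exact Or.inr (by_contra fun hxX => hx ⟨hxB, hxX⟩)
          · exact Or.inl ⟨hxg, hxB⟩
        · rintro (⟨hxg, hxB⟩ | hxX)
          · exact ⟨hxg, fun h => hxB h.1⟩
          · exact ⟨hBg (hXB hxX), fun h => h.2 hxX⟩
      rw [h1]
      exact hXs
    · rw [Finset.sdiff_sdiff_eq_self hXB]
      exact hXk
  have hdisj := card_le_card_nullity_disjoint (M✶) k 𝒜 hmem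
  -- the candidates, complemented, are supersets spanning up to k points
  have hmap : ((gr (M✶)).powerset.filter (fun T : Finset α =>
      (∃ I ⊆ T, (M✶).Indep (I : Set α) ∧ (T \ I).card ≤ k) ∧ ∃ B ∈ 𝒜, Disjoint T B)).card ≤
      ((gr M).powerset.filter (fun S : Finset α =>
        (∃ X ⊆ gr M \ S, X.card ≤ k ∧ M.Spanning ((S ∪ X : Finset α) : Set α)) ∧ ∃ B ∈ 𝒜, B ⊆ S)).card := by
    apply Finset.card_le_card_of_injOn (fun T : Finset α => gr M \ T)
    · intro T hT
      rw [Finset.mem_coe, Finset.mem_filter, Finset.mem_powerset, gr_dual] at hT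
      obtain ⟨hTg, ⟨I, hIT, hI, hIk⟩, B, hB, hdis⟩ := hT
      rw [Finset.mem_coe, Finset.mem_filter, Finset.mem_powerset]
      refine ⟨Finset.sdiff_subset, ⟨T \ I, ?_, hIk, ?_⟩, B, hB, ?_⟩
      · rw [Finset.sdiff_sdiff_eq_self hTg]
        exact Finset.sdiff_subset
      · have h1 : M.Spanning (M.E \ (I : Set α)) := (Matroid.coindep_def.2 hI).compl_spanning
        have h2 : (((gr M \ T) ∪ (T \ I) : Finset α) : Set α) = M.E \ (I : Set α) := by
          rw [← coe_gr, Finset.coe_union, Finset.coe_sdiff, Finset.coe_sdiff]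
          ext x
          simp only [Set.mem_sdiff, Set.mem_union, Finset.mem_coe]
          constructor
          · rintro (⟨hxg, hxT⟩ | ⟨hxT, hxI⟩)
            · exact ⟨hxg, fun h => hxT (hIT h)⟩
            · exact ⟨hTg hxT, hxI⟩
          · rintro ⟨hxg, hxI⟩
            by_cases hxT : x ∈ T
            · exact Or.inr ⟨hxT, hxI⟩
            · exact Or.inl ⟨hxg, hxT⟩
        rw [h2]
        exact h1
      · rw [Finset.subset_sdiff]
        exact ⟨(h𝒜 B hB).1, hdis.symm⟩
    · intro T hT T' hT' heq
      rw [Finset.mem_coe, Finset.mem_filter, Finset.mem_powerset, gr_dual] at hT hT'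
      simp only at heq
      rw [← Finset.sdiff_sdiff_eq_self hT.1, ← Finset.sdiff_sdiff_eq_self hT'.1, heq]
  exact hdisj.trans hmap

end TopHall

end PercRepro
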